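import Literature.NumberTheory.EllipticCurves.ModularFunctionField
import Literature.NumberTheory.EllipticCurves.EtaQuotientQExpansionProofs
import Literature.NumberTheory.EllipticCurves.ModularCurveGenusTwoProofs
import HarnessLib

/-!
# The modular function field `K_M ⊆ ℂ((q))` along the `Γ₀`-tower: level change, monomials, `η`-quotients
(cell `bsd-f2-manin`, planner `-an` g36, MEMO-an §79 / §79.9; proposed tree path
`Literature/NumberTheory/EllipticCurves/ModularFunctionFieldEtaProofs.lean`; everything [folklore], no proof gaps)

TYPER NOTE (typer g19, T-an-39 (b) file L, part 1/2).  SOURCE = HOME/an/g36/ModularFunctionFieldEtaProofs-an-g36.lean sha16 a1577e89bb8f6fea (626 l.;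
an: `lean check --no-snap` rc 0 · 0 err · 0 warn, axioms standard; chain check CubeDescentFullSim2-an-g36.lean bd9356bc34bd2dc1), Parts I–II (an's
lines 1–317) VERBATIM except: this note; one-line `[folklore]` docstrings on undocumented helper lemmas; an's `Gamma0_le_of_dvd` replaced by the
tree's identical `gamma0_le_gamma0_of_dvd` (`ModularCurveGenusTwoProofs`, now imported; gate `dedup.landed`); and the HOME of the file: an proposed
`Literature/NumberTheory/EllipticCurves/ModularFunctionFieldEtaProofs.lean`, but the gate's `lint.literature-cited-only` (dry-run 11:2xZ) refuses
uncited public theorems in Literature («new results belong under Summits/<Summit>/»), and M0/M2 have no printed theorem number to cite honestly — so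
the proofs land HERE, under the summit, namespace `Summit.BirchSwinnertonDyer.Rank1Residual.ManinAdditive.ModularFunctionFieldEta` (was `Literature.NumberTheory.EllipticCurves.ModularForms`;
the tree objects are reached through `open`), split for the 400-line cap into part 1 (this file: M0 level change, M2 no monomial) and part 2
`ModularFunctionFieldEta.lean` (M1 η-quotients + the objects `toLaurent/etaPos/etaNeg/etaLaurent`).  CONSUMERS: an's FILE F (`…Theorems/
ManinLocalTwoThreeCubeRootDescentClosed.lean`, prover-landed) must import `…ManinAdditive.ModularFunctionFieldEta` and `open Summit.BirchSwinnertonDyer.Rank1Residual.ManinAdditive.ModularFunctionFieldEta`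
instead of the Literature path.  Theorem-only apart from the plumbing defs `ofLevelDvd`, `gammaLow`; nothing conjectured; no instance / notation.
PARTITION 0 · beyond-print theorem: no · BSD is not proved by this; C2/C3 OPEN.

Three facts about the tree's `modularFunctionField M` (`ModularFunctionField.lean` :157, the subfield of `ℂ((q))` of
quotients of `q`-expansions at `∞` of `Γ₀(M)`-modular forms of equal weight), which the cell's cube-root descent for the
cube-exponent law LAW₃ (`CuspidalKummerCubeLaws.lean`) had to assume as the packaging leaves M0 / M1 / M2:

* **M0** `modularFunctionField_mono : M ∣ M' → modularFunctionField M ≤ modularFunctionField M'` (restriction of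
  `Γ₀(M)`-forms to `Γ₀(M')`, `ofLevelDvd`, same `q`-expansion);
* **M2** `monomial_mem_modularFunctionField_imp : HahnSeries.single m 1 ∈ modularFunctionField M → m = 0` (a relation
  `q^d·G = F` of forms with `d ≠ 0` is slashed by `γ₀ = (1 0; M 1) ∈ Γ₀(M)`, which moves `Im τ` DOWN, so `G` vanishes on
  `Im τ > 1`, hence `G = 0` by the identity theorem for the cusp function);
* **M1** `etaLaurent_mem_modularFunctionField : NewmanCond M s 0 → etaLaurent M s ∈ modularFunctionField M`: write
  `η_s = F/G` with `F = ∏ η(δτ)^{s_δ+24n}`, `G = ∏ η(δτ)^{24n}`, `n = 1 + Σ|s_δ|`; both exponent vectors satisfy Newman's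
  conditions in weight `12nσ₀(M)` (squareness of `∏ δ^{|s_δ+24n|}` from that of `∏ δ^{|s_δ|}`: `X·A² = Y² ⟹ X square`)
  with every Ligozat order positive, so `F`, `G` are the tree's `etaQuotientCuspForm`s [Savitt2025, Thm. 1 as typed in
  `ModularCurveEtaQuotientsProofs`]; their `q`-expansions are `X^e·∏ E(X^δ)^{r_δ}` by the `q`-expansion principle
  (`qExpansion_one_coeff_eq_of_hasSum`) and the ratio is `etaLaurent M s = q^{S₁(s)/24}·etaPos/etaNeg`.

The objects `toLaurent`, `etaPos`, `etaNeg`, `etaLaurent` are defined here with bodies identical to the cell's statement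
file `CuspidalKummerCubeDescent.lean` (FILE A), so the cell's `Prop`s M0/M1/M2 are closed by `exact` (FILE F).
PARTITION unchanged · beyond-print theorem: no · BSD is not proved by this.
-/

noncomputable section

open UpperHalfPlane hiding I
open ModularForm SlashInvariantForm ModularFormClass Complex CongruenceSubgroup Filter Function PowerSeries
open scoped MatrixGroups Real Topology

open Literature.NumberTheory.EllipticCurves.ModularForms

namespace Summit.BirchSwinnertonDyer.Rank1Residual.ManinAdditive.ModularFunctionFieldEta

/-! ## Part I — M0: level change `K_M ≤ K_{M'}` for `M ∣ M'` -/

/-! `M ∣ M' → Γ₀(M') ≤ Γ₀(M)` is the tree's `gamma0_le_gamma0_of_dvd` (`ModularCurveGenusTwoProofs`); an's local copy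
`Gamma0_le_of_dvd` was dropped (gate `dedup.landed`). -/

/-- A `Γ₀(M)`-form viewed as a `Γ₀(M')`-form for `M ∣ M'`. [folklore] -/
def ofLevelDvd {M M' : ℕ} (h : M ∣ M') {k : ℤ} (f : ModularForm (Gamma0 M) k) : ModularForm (Gamma0 M') k where
  toFun := f
  slash_action_eq' A hA := by
    obtain ⟨γ, hγ, rfl⟩ := hA
    exact f.slash_action_eq' _ ⟨γ, gamma0_le_gamma0_of_dvd h hγ, rfl⟩
  holo' := f.holo'
  bdd_at_cusps' hc := f.bdd_at_cusps' (hc.mono fun A hA ↦ by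
    obtain ⟨γ, hγ, rfl⟩ := hA
    exact ⟨γ, gamma0_le_gamma0_of_dvd h hγ, rfl⟩)

/-- `ofLevelDvd` does not change the underlying function. [folklore] -/
@[simp]
theorem coe_ofLevelDvd {M M' : ℕ} (h : M ∣ M') {k : ℤ} (f : ModularForm (Gamma0 M) k) :
    (ofLevelDvd h f : ℍ → ℂ) = f := rfl

/-- `ofLevelDvd` does not change the `q`-expansion (definitional). [folklore] -/
theorem qExpansionL_ofLevelDvd {M M' : ℕ} (h : M ∣ M') {k : ℤ} (f : ModularForm (Gamma0 M) k) :
    qExpansionL M' (ofLevelDvd h f) = qExpansionL M f := rfl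

/-- `ofLevelDvd` of a non-zero form is non-zero. [folklore] -/
theorem ofLevelDvd_ne_zero {M M' : ℕ} (h : M ∣ M') {k : ℤ} {f : ModularForm (Gamma0 M) k} (hf : f ≠ 0) :
    ofLevelDvd h f ≠ 0 := by
  intro h0
  apply hf
  have hfun : (ofLevelDvd h f : ℍ → ℂ) = 0 := by rw [h0]; rfl
  rw [coe_ofLevelDvd] at hfun
  exact DFunLike.ext f 0 fun τ => by rw [show f τ = (f : ℍ → ℂ) τ from rfl, hfun]; rfl

/-- **M0 (PROVED): the modular function field is monotone in the level**, `M ∣ M' ⟹ K_M ≤ K_{M'}`. [folklore] -/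
theorem modularFunctionField_mono {M M' : ℕ} (h : M ∣ M') : modularFunctionField M ≤ modularFunctionField M' := by
  rintro x ⟨k, F, G, hG, hx⟩
  exact ⟨k, ofLevelDvd h F, ofLevelDvd h G, ofLevelDvd_ne_zero h hG, by
    rw [qExpansionL_ofLevelDvd, qExpansionL_ofLevelDvd]; exact hx⟩

/-- M0 in the exact shape of FILE A's `CuspidalKummerThree.ModularFunctionFieldMono`
(`∀ (M M' : ℕ) [NeZero M'], M ∣ M' → modularFunctionField M ≤ modularFunctionField M'`). [folklore] -/
theorem modularFunctionFieldMono_shape :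
    ∀ (M M' : ℕ) [NeZero M'], M ∣ M' → modularFunctionField M ≤ modularFunctionField M' :=
  fun _ _ _ h => modularFunctionField_mono h


/-! ## Part II — M2: no non-constant monomial `q^m` is a modular function -/

variable {M : ℕ}

/-! ### Coefficients of `qExpansionL` -/

/-- Coefficients of `qExpansionL` at natural indices are the `q`-expansion coefficients. [folklore] -/
theorem coeff_qExpansionL_natCast {k : ℤ} (F : ModularForm (Gamma0 M) k) (n : ℕ) :
    (qExpansionL M F).coeff (n : ℤ) = (qExpansion 1 F).coeff n := by
  rw [qExpansionL_def, PowerSeries.coeff_coe, if_neg (by omega), Int.natAbs_natCast]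

/-- Coefficients of `qExpansionL` at negative indices vanish. [folklore] -/
theorem coeff_qExpansionL_of_neg {k : ℤ} (F : ModularForm (Gamma0 M) k) {i : ℤ} (hi : i < 0) :
    (qExpansionL M F).coeff i = 0 := by
  rw [qExpansionL_def, PowerSeries.coeff_coe, if_pos hi]

/-- A relation `q^d · G = F` shifts the coefficients of `G` by `d`. [folklore] -/
theorem coeff_shift_of_single_mul {k : ℤ} {F G : ModularForm (Gamma0 M) k} {d : ℕ}
    (h : HahnSeries.single (d : ℤ) (1 : ℂ) * qExpansionL M G = qExpansionL M F) (n : ℕ) :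
    (qExpansion 1 F).coeff (n + d) = (qExpansion 1 G).coeff n := by
  have := congrArg (fun x ↦ x.coeff ((n : ℤ) + d)) h
  rw [HahnSeries.coeff_single_mul_add, one_mul, coeff_qExpansionL_natCast, ← Nat.cast_add,
    coeff_qExpansionL_natCast] at this
  exact this.symm

/-- A relation `q^d · G = F` forces the low coefficients of `F` to vanish. [folklore] -/
theorem coeff_eq_zero_of_single_mul_of_lt {k : ℤ} {F G : ModularForm (Gamma0 M) k} {d : ℕ}
    (h : HahnSeries.single (d : ℤ) (1 : ℂ) * qExpansionL M G = qExpansionL M F) {j : ℕ}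
    (hj : j < d) : (qExpansion 1 F).coeff j = 0 := by
  have := congrArg (fun x ↦ x.coeff (((j : ℤ) - d) + d)) h
  rw [HahnSeries.coeff_single_mul_add, one_mul, sub_add_cancel,
    coeff_qExpansionL_of_neg G (by omega), coeff_qExpansionL_natCast] at this
  exact this.symm

/-! ### Convergent `q`-expansions of `Γ₀(M)`-forms -/

/-- The `q`-expansion of a `Γ₀(M)`-form sums to its value (named apart from the tree's `hasSum_qExpansion_gamma0`). [folklore] -/
theorem hasSum_qExpansion_gamma0_form {k : ℤ} (F : ModularForm (Gamma0 M) k) (τ : ℍ) :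
    HasSum (fun m : ℕ ↦ (qExpansion 1 F).coeff m • Periodic.qParam 1 (τ : ℂ) ^ m) (F τ) := by
  haveI : Fact (IsCusp OnePoint.infty (Gamma0 M : Subgroup (GL (Fin 2) ℝ))) :=
    ⟨(Gamma0 M : Subgroup (GL (Fin 2) ℝ)).isCusp_of_mem_strictPeriods one_pos
      (one_mem_strictPeriods_coe_gamma0 M)⟩
  exact UpperHalfPlane.hasSum_qExpansion one_pos
    (SlashInvariantFormClass.periodic_comp_ofComplex F (one_mem_strictPeriods_coe_gamma0 M))
    (ModularFormClass.holo F) (ModularFormClass.bdd_at_infty F) τ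

/-- `q^d · q-exp(G) = q-exp(F)` forces `F(τ) = q(τ)^d G(τ)` on `ℍ`. [folklore] -/
theorem apply_eq_qParam_pow_mul_apply {k : ℤ} {F G : ModularForm (Gamma0 M) k} {d : ℕ}
    (h : HahnSeries.single (d : ℤ) (1 : ℂ) * qExpansionL M G = qExpansionL M F) (τ : ℍ) :
    F τ = Periodic.qParam 1 (τ : ℂ) ^ d * G τ := by
  set q := Periodic.qParam 1 (τ : ℂ) with hq
  have hG := hasSum_qExpansion_gamma0_form G τ
  have hF := hasSum_qExpansion_gamma0_form F τ
  have h1 : HasSum (fun m : ℕ ↦ (qExpansion 1 F).coeff (m + d) • q ^ (m + d)) (q ^ d * G τ) := by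
    have := hG.mul_left (q ^ d)
    have hfun : (fun i : ℕ ↦ q ^ d * ((qExpansion 1 G).coeff i • Periodic.qParam 1 (τ : ℂ) ^ i)) =
        (fun m : ℕ ↦ (qExpansion 1 F).coeff (m + d) • q ^ (m + d)) := by
      funext m
      rw [coeff_shift_of_single_mul h m, smul_eq_mul, smul_eq_mul, pow_add, ← hq]
      ring
    rw [hfun] at this
    exact this
  have h2 := (hasSum_nat_add_iff (f := fun m : ℕ ↦ (qExpansion 1 F).coeff m • q ^ m) d).mp h1
  have h3 : ∑ i ∈ Finset.range d, (qExpansion 1 F).coeff i • q ^ i = 0 :=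
    Finset.sum_eq_zero fun i hi ↦ by
      rw [coeff_eq_zero_of_single_mul_of_lt h (Finset.mem_range.mp hi), zero_smul]
  rw [h3, add_zero] at h2
  exact hF.unique h2

/-! ### The element `γ₀ = (1 0; M 1) ∈ Γ₀(M)` -/

/-- `γ₀ = (1 0; M 1)`. [folklore] -/
def gammaLow (M : ℕ) : SL(2, ℤ) :=
  ⟨!![1, 0; (M : ℤ), 1], by rw [Matrix.det_fin_two_of]; ring⟩

/-- Lower-left entry of `gammaLow M` is `M`. [folklore] -/
theorem gammaLow_one_zero (M : ℕ) : (gammaLow M : Matrix (Fin 2) (Fin 2) ℤ) 1 0 = M := rfl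

/-- Lower-right entry of `gammaLow M` is `1`. [folklore] -/
theorem gammaLow_one_one (M : ℕ) : (gammaLow M : Matrix (Fin 2) (Fin 2) ℤ) 1 1 = 1 := rfl

/-- `gammaLow M = (1 0; M 1)` lies in `Γ₀(M)`. [folklore] -/
theorem gammaLow_mem (M : ℕ) : gammaLow M ∈ Gamma0 M := by
  rw [Gamma0_mem]
  show (((gammaLow M : Matrix (Fin 2) (Fin 2) ℤ) 1 0 : ℤ) : ZMod M) = 0
  rw [gammaLow_one_zero, Int.cast_natCast, ZMod.natCast_self]

/-- The automorphy denominator of `gammaLow M` at `τ` is `M τ + 1`. [folklore] -/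
theorem denom_gammaLow (M : ℕ) (τ : ℍ) :
    denom (gammaLow M : GL (Fin 2) ℝ) τ = (M : ℂ) * τ + 1 := by
  rw [ModularGroup.denom_apply, gammaLow_one_zero, gammaLow_one_one]
  push_cast
  ring

/-- `gammaLow M` moves points with `Im τ > 1` strictly DOWN. [folklore] -/
theorem im_gammaLow_smul_lt (hM : 0 < M) {τ : ℍ} (hτ : 1 < τ.im) :
    (gammaLow M • τ).im < τ.im := by
  rw [ModularGroup.im_smul_eq_div_normSq, denom_gammaLow]
  have hpos : 0 < τ.im := τ.im_pos
  have hre : ((M : ℂ) * τ + 1).re = M * τ.re + 1 := by simp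
  have him : ((M : ℂ) * τ + 1).im = M * τ.im := by simp
  have hnorm : 1 < Complex.normSq ((M : ℂ) * τ + 1) := by
    rw [Complex.normSq_apply, hre, him]
    have hM1 : (1 : ℝ) ≤ M := by exact_mod_cast hM
    have h1 : 1 < (M : ℝ) * τ.im := by nlinarith
    nlinarith [sq_nonneg ((M : ℝ) * τ.re + 1)]
  exact div_lt_self hpos hnorm

/-- `q(γ₀ τ)^d ≠ q(τ)^d` for `Im τ > 1`, `d ≠ 0`. [folklore] -/
theorem qParam_pow_gammaLow_ne (hM : 0 < M) {τ : ℍ} (hτ : 1 < τ.im) {d : ℕ} (hd : d ≠ 0) :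
    Periodic.qParam 1 (((gammaLow M • τ : ℍ)) : ℂ) ^ d ≠ Periodic.qParam 1 (τ : ℂ) ^ d := by
  intro h
  have hn := congrArg (fun z : ℂ ↦ ‖z‖) h
  simp only [norm_pow, Periodic.norm_qParam, UpperHalfPlane.coe_im, div_one] at hn
  have hlt : Real.exp (-2 * π * τ.im) < Real.exp (-2 * π * (gammaLow M • τ).im) := by
    apply Real.exp_lt_exp.mpr
    have := im_gammaLow_smul_lt hM hτ
    nlinarith [Real.pi_pos]
  have := pow_lt_pow_left₀ hlt (Real.exp_pos _).le hd
  linarith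

/-! ### The main step: `q^d · q-exp(G) = q-exp(F)` with `d ≥ 1` forces `G = 0` -/

/-- A relation `q^d · G = F` of `Γ₀(M)`-forms of equal weight with `d ≠ 0` forces `G = 0`. [folklore] -/
theorem eq_zero_of_single_mul [NeZero M] {k : ℤ} {F G : ModularForm (Gamma0 M) k} {d : ℕ}
    (hd : d ≠ 0) (h : HahnSeries.single (d : ℤ) (1 : ℂ) * qExpansionL M G = qExpansionL M F) :
    G = 0 := by
  -- (A) `G τ = 0` whenever `Im τ > 1`
  have hvan : ∀ τ : ℍ, 1 < τ.im → G τ = 0 := by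
    intro τ hτ
    have hγ : gammaLow M ∈ Gamma0 M := gammaLow_mem M
    have hFγ : F (gammaLow M • τ) = denom (gammaLow M : GL (Fin 2) ℝ) τ ^ k * F τ :=
      SlashInvariantForm.slash_action_eqn_SL'' F hγ τ
    have hGγ : G (gammaLow M • τ) = denom (gammaLow M : GL (Fin 2) ℝ) τ ^ k * G τ :=
      SlashInvariantForm.slash_action_eqn_SL'' G hγ τ
    have e1 := apply_eq_qParam_pow_mul_apply h τ
    have e2 := apply_eq_qParam_pow_mul_apply h (gammaLow M • τ)
    rw [hFγ, hGγ, e1] at e2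
    have hD : denom (gammaLow M : GL (Fin 2) ℝ) τ ^ k ≠ 0 := zpow_ne_zero _ (denom_ne_zero _ _)
    by_contra hG0
    have e3 : denom (gammaLow M : GL (Fin 2) ℝ) τ ^ k * (Periodic.qParam 1 (τ : ℂ) ^ d * G τ) =
        denom (gammaLow M : GL (Fin 2) ℝ) τ ^ k *
          (Periodic.qParam 1 (((gammaLow M • τ : ℍ)) : ℂ) ^ d * G τ) := by
      rw [e2]; ring
    have e4 := mul_left_cancel₀ hD e3
    have e5 := mul_right_cancel₀ hG0 e4
    exact qParam_pow_gammaLow_ne (NeZero.pos M) hτ hd e5.symm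
  -- (B) the cusp function of `G` vanishes on a punctured disc around `0`
  have hper := SlashInvariantFormClass.periodic_comp_ofComplex G (one_mem_strictPeriods_coe_gamma0 M)
  have hcusp : ∀ q : ℂ, q ≠ 0 → ‖q‖ < Real.exp (-2 * π) → cuspFunction 1 G q = 0 := by
    intro q hq0 hq
    have hqpos : 0 < ‖q‖ := norm_pos_iff.mpr hq0
    have hlog : Real.log ‖q‖ < -2 * π := by rwa [Real.log_lt_iff_lt_exp hqpos]
    have him : 1 < (Periodic.invQParam 1 q).im := by
      rw [Periodic.im_invQParam]
      have : -(1 : ℝ) / (2 * π) * Real.log ‖q‖ = -Real.log ‖q‖ / (2 * π) := by ring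
      rw [this, lt_div_iff₀ (by positivity)]
      linarith
    have him0 : 0 < (Periodic.invQParam 1 q).im := by linarith
    let τ : ℍ := ⟨Periodic.invQParam 1 q, him0⟩
    have hτq : Periodic.qParam 1 (τ : ℂ) = q := Periodic.qParam_right_inv one_ne_zero hq0
    have hc := UpperHalfPlane.eq_cuspFunction τ one_ne_zero hper
    rw [hτq] at hc
    rw [hc]
    exact hvan τ him
  -- (C) analytic at `0` and zero on a punctured disc ⟹ zero near `0`
  have han : AnalyticAt ℂ (cuspFunction 1 G) 0 :=
    ModularFormClass.analyticAt_cuspFunction_zero G one_pos (one_mem_strictPeriods_coe_gamma0 M)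
  have hev : ∀ᶠ z in 𝓝 (0 : ℂ), cuspFunction 1 G z = 0 := by
    rcases han.eventually_eq_zero_or_eventually_ne_zero with h0 | hne
    · exact h0
    · exfalso
      have hz : ∀ᶠ z in 𝓝[≠] (0 : ℂ), cuspFunction 1 G z = 0 := by
        have hball : Metric.ball (0 : ℂ) (Real.exp (-2 * π)) ∈ 𝓝 (0 : ℂ) :=
          Metric.ball_mem_nhds _ (Real.exp_pos _)
        filter_upwards [mem_nhdsWithin_of_mem_nhds hball, self_mem_nhdsWithin] with z hz hz0
        exact hcusp z hz0 (by simpa using hz)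
      obtain ⟨z, h1, h2⟩ := (hne.and hz).exists
      exact h1 h2
  -- (D) all Taylor coefficients vanish, so `q-exp(G) = 0` and `G = 0`
  have hq0 : qExpansion 1 G = 0 := by
    ext m
    rw [UpperHalfPlane.qExpansion_coeff, map_zero]
    have : iteratedDeriv m (cuspFunction 1 G) 0 = iteratedDeriv m (fun _ : ℂ ↦ (0 : ℂ)) (0 : ℂ) :=
      Filter.EventuallyEq.iteratedDeriv_eq m hev
    rw [this, iteratedDeriv_fun_const_zero, mul_zero]
  refine (qExpansionL_eq_zero_iff M G).mp ?_
  rw [qExpansionL_def, hq0, PowerSeries.coe_zero]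

/-- **M2 (PROVED): a monomial `q^m` is the `q`-expansion of a modular function for `Γ₀(M)` only if
`m = 0`.** [folklore] -/
theorem monomial_mem_modularFunctionField_imp (M : ℕ) [NeZero M] (m : ℤ)
    (hm : HahnSeries.single m (1 : ℂ) ∈ modularFunctionField M) : m = 0 := by
  obtain ⟨k, F, G, hG, hx⟩ := hm
  by_contra hm0
  rcases lt_or_gt_of_ne hm0 with hneg | hpos
  · -- `m < 0`: `q^{-m} · q-exp(F) = q-exp(G)` with `F ≠ 0`
    obtain ⟨d, hd⟩ := Int.eq_ofNat_of_zero_le (neg_nonneg.mpr hneg.le)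
    have hF : F ≠ 0 := by
      intro hF0
      apply hG
      rw [hF0, qExpansionL_zero] at hx
      exact (qExpansionL_eq_zero_iff M G).mp
        ((mul_eq_zero.mp hx).resolve_left (HahnSeries.single_ne_zero one_ne_zero))
    have hx' : HahnSeries.single (d : ℤ) (1 : ℂ) * qExpansionL M F = qExpansionL M G := by
      rw [← hx, ← mul_assoc, HahnSeries.single_mul_single, mul_one, ← hd, neg_add_cancel,
        HahnSeries.single_zero_one, one_mul]
    have hd0 : d ≠ 0 := by rintro rfl; simp at hd; omega
    exact hF (eq_zero_of_single_mul hd0 hx')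
  · -- `m > 0`
    obtain ⟨d, rfl⟩ := Int.eq_ofNat_of_zero_le hpos.le
    have hd0 : d ≠ 0 := by rintro rfl; simp at hpos
    exact hG (eq_zero_of_single_mul hd0 hx)

/-- M2 in the exact shape of FILE A's `CuspidalKummerThree.MonomialNotModularFunction`
(`∀ (M : ℕ) [NeZero M] (m : ℤ), HahnSeries.single m (1 : ℂ) ∈ modularFunctionField M → m = 0`). [folklore] -/
theorem monomialNotModularFunction_shape :
    ∀ (M : ℕ) [NeZero M] (m : ℤ), HahnSeries.single m (1 : ℂ) ∈ modularFunctionField M → m = 0 :=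
  fun M _ m hm ↦ monomial_mem_modularFunctionField_imp M m hm

end Summit.BirchSwinnertonDyer.Rank1Residual.ManinAdditive.ModularFunctionFieldEta

end
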